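import Summits.BirchSwinnertonDyer.Rank1Residual.Additive.GordCycLowerBoundOfControlTamagawa
import Summits.BirchSwinnertonDyer.Rank1Residual.Additive.GordCycLowerBoundOfControlEnds
import HarnessLib

/-!
# `BSD(E,p)` on rank-`0` X4(M) / X4♯(G-ord) rows from the ONE typed lower input `CycLowerBoundAt` by
# TAMAGAWA-TOLERANT control: the (M) twins and the covered-locus capstones (team n1011, row T-CTL-TAM,
# seat p06 GEN 10, FILE 5 — ENDs over FILE 4; r2 GEN 34's ask, cell INBOX 01:42Z)

HONEST FRAMING (cell `b2b-bsdres-*`, team n1011, verbatim): prove what is provable now; shrink each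
hard class to its core with data; no claim beyond stated classes. Research route on
CONSTRUCTION-SHAPED X4 / §I N10–N11; TOOL + CONSUMER theorems only — no definition, no named fact,
nothing booked, no residual-map mark moved, no class closed. The typed input
`CycLowerBoundAt W p Dh` (additive-p2, OPEN) is consumed, not touched.

## What

FILE 4 (`Additive/GordCycLowerBoundOfControlTamagawa`) proved the rank-`0` lower half
`CycLowerBoundAt ⟹ Typed.MissingLowerBoundAt` with the bad-place socket of T-CTL-EC weakened from
`p ∤ c_ℓ · N_ℓ` to `p ∤ N_ℓ` (`N_ℓ = #Ẽ_ns(𝔽_ℓ)`), and its X4♯/X3♯(G-ord) ENDs. r2's census column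
(GEN 34, `cells/n1011/route2/g34/CTLTAM-weak-socket-column-g34.tsv.xz`; EVIDENCE) reads the weak
socket on the 13 `OPEN:LOWER(+M)+TAM` demand rows @ ≥ 5 as PASS 8/13 — ALL EIGHT of cell (M) — and
on the `p = 3`, `W = 2` TAM receivers as PASS 144/510 (M 124, Gord3 20). Hence the (M) twins, exactly
in the shape of T-CTL-EC FILE 3 (`Additive/GordCycLowerBoundOfControlEnds`), modulo Tate's
uniformisation A41 (`hT41`, the `v ∋ p` socket of p12's T-T3M `AdditivePotMult.ClassX4M.localTowerKerPrimary_zero_eq_bot`):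

* `ClassX4M.missingLowerBoundAt_rankZero_of_cycLowerBound_tamagawa` — X4(M), rank `0`, EVERY odd
  `p` (incl. `3`): binders `hT41`, `hX`, `hGZK`, `hr`, `S / hS / hgood` (at the bad `ℓ ≠ p` ONLY
  `p ∤ N_ℓ`), `Dh`, `hlow`; binder diff against T-CTL-EC's `ClassX4M.…_allNumeric`: the ONE clause
  `¬ p ∣ c_ℓ · N_ℓ ↦ ¬ p ∣ N_ℓ`;
* `ClassX3M.missingLowerBoundAt_rankZero_of_cycLowerBound_tamagawa` — X3♯(M) twin, `htors` explicit;
* `ClassX4M.bsdp_rankZero_of_facts_of_cycLowerBound_tamagawa` — **X4(M), `r_an = 0`, `ρ̄` onto, EVERY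
  odd `p`: `BSD(E,p)` from PRINTED facts (`hT41`, `hDel98`, `hGZK`, `hmod`, `hmodD`, `hL20`, `hKato`),
  census place data with ONLY `p ∤ N_ℓ` at the bad `ℓ ≠ p`, and the ONE typed input** — upper half
  the class-wide kernel theorem `AdditivePotMult.ClassX4M.missingUpperBoundAt_rankZero_of_surj`, lower
  half the (M) twin above (the shape of T-CTL-EC's `ClassX4M.bsdp_rankZero_of_facts_of_cycLowerBound`);
* (no X4♯(G-ord) covered-locus capstone twin: T-CTL-EC FILE 3's `…_of_facts[ManinFree]_…` upper
  halves carry `ord_p Tam = ord_p c_p` resp. `p ∤ Tam`, i.e. they live OFF the Tamagawa rows; the (G-ord)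
  capstones of the Tamagawa-tolerant lower half are FILE 4's `…_of_katoComponent_…` / `…_of_cycLeadingTerm_…`.)

On r2's reading the 8 (M) demand rows @ 5 and the (M)-surj receivers @ 3 then sit on the footing of
the `B = 0` `OPEN:LOWER(M)` rows: `BSDp ⇐ printed facts + hT41 + CycLowerBoundAt`. NOT claimed: the
typed input (OPEN — nothing closes); the 5 demand rows failing `p ∤ N_ℓ` (they need the sharp
`c_ℓ^{(p)}`, X11b's currency only); the `W = 0` `OPEN:TAM` rows; rank `1`; any census label (EVIDENCE,
r2's and the lead's word). Axioms standard.

References: [GreenbergLNM1716] §3 Lemma 3.3 (pp. 86–88), Lemma 3.5 (p. 90), Prop. 3.8 (pp. 95–96),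
§4 Thm. 4.1 (pp. 102–104); [SilvermanATAEC1994] V Thm. 5.3 / Cor. 5.4; [Delbourgo1998] Prop. 4,
§2.2 Lemma (ii); [Wuthrich2014] Lemma 20; [Miller2011LMS] Def. 1.1; cells/n1011/skel/T-CTL-TAM.md.
-/

noncomputable section

open scoped Classical NumberField

open WeierstrassCurve NumberField Literature.NumberTheory.EllipticCurves
  Literature.NumberTheory.EllipticCurves.ModularForms
  Literature.NumberTheory.EllipticCurves.Rank1Residual
  Literature.NumberTheory.EllipticCurves.Rank1Residual.Typed
  IsDedekindDomain Rat.HeightOneSpectrum Summit.BirchSwinnertonDyer.Rank1Residual.Iwasawa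

namespace Summit.BirchSwinnertonDyer.Rank1Residual.Additive

variable {W : WeierstrassCurve ℚ} [W.IsElliptic] {p : ℕ} [hp : Fact p.Prime]

/-! ### §1 The (M) twins of the Tamagawa-tolerant lower half -/

/-- **X4(M), rank `0`, EVERY odd `p` (incl. `p = 3`): the lower half from the typed input by
Tamagawa-tolerant control, mod A41.** The socket above `p` is p12's T-T3M
`AdditivePotMult.ClassX4M.localTowerKerPrimary_zero_eq_bot hT41` (every `ℤ_p`-extension); `p ∤ #tors`
is `Irr`; at the bad places away from `p` ONLY `p ∤ N_ℓ = #Ẽ_ns(𝔽_ℓ)` — the Tamagawa numbers are free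
(binder diff vs T-CTL-EC's `ClassX4M.…_allNumeric`: `¬ p ∣ c_ℓ · N_ℓ ↦ ¬ p ∣ N_ℓ`, nothing added).
X4(M) stays CONSTRUCTION-SHAPED; the typed input stays OPEN; nothing booked.
[cite: SilvermanATAEC1994, Ch. V Thm. 5.3, Cor. 5.4] [cite: Delbourgo1998, §2.2 Lemma (ii) (p. 139)]
[cite: GreenbergLNM1716, §3 Lemma 3.3 (pp. 86–88), Lemma 3.5 (p. 90), Prop. 3.8 (pp. 95–96) and §4 Thm. 4.1 (pp. 102–104)]
[cite: Miller2011LMS, Def. 1.1] -/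
theorem ClassX4M.missingLowerBoundAt_rankZero_of_cycLowerBound_tamagawa [W.IsGloballyMinimal]
    (hT41 : Silverman1994_thmV53_corV54_tateUniformisation.{0})
    (hX : AdditivePotMult.ClassX4M W p)
    (hGZK : rank_eq_analyticRank_of_analyticRank_le_one) (hr : W.analyticRank = 0)
    (S : Finset (HeightOneSpectrum (𝓞 ℚ)))
    (hS : ∀ v ∈ S, (p : 𝓞 ℚ) ∉ v.asIdeal →
      (primesEquiv v : ℕ) ≠ p ∧ ¬ p ∣ reductionPointCount W (primesEquiv v : ℕ))
    (hgood : ∀ v ∉ S, (p : 𝓞 ℚ) ∉ v.asIdeal ∧ W.HasGoodReductionAt v)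
    (Dh : PAdicHeightData W p) (hlow : CycLowerBoundAt W p Dh) :
    MissingLowerBoundAt W p :=
  missingLowerBoundAt_rankZero_of_cycLowerBound_weakSocket W p hGZK hr
    (Supersingular.not_dvd_torsionOrder_of_irr W p hX.irr) S hS
    (fun κ _ _ hpv ↦ AdditivePotMult.ClassX4M.localTowerKerPrimary_zero_eq_bot hT41 hX hpv κ) hgood Dh
    hlow

/-- **X3♯(M), rank `0`, EVERY odd `p`, `p ∤ #E(ℚ)_tors` explicit: the lower half from the typed input
by Tamagawa-tolerant control, mod A41** (away from `p`: `p ∤ N_ℓ` only). Nothing booked.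
[cite: SilvermanATAEC1994, Ch. V Thm. 5.3, Cor. 5.4]
[cite: GreenbergLNM1716, §3 Lemma 3.3 (pp. 86–88), Lemma 3.5 (p. 90), Prop. 3.8 (pp. 95–96) and §4 Thm. 4.1 (pp. 102–104)]
[cite: Miller2011LMS, Def. 1.1] -/
theorem ClassX3M.missingLowerBoundAt_rankZero_of_cycLowerBound_tamagawa [W.IsGloballyMinimal]
    (hT41 : Silverman1994_thmV53_corV54_tateUniformisation.{0})
    (hX : AdditivePotMult.ClassX3M W p)
    (hGZK : rank_eq_analyticRank_of_analyticRank_le_one) (hr : W.analyticRank = 0)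
    (htors : ¬ p ∣ W.torsionOrder) (S : Finset (HeightOneSpectrum (𝓞 ℚ)))
    (hS : ∀ v ∈ S, (p : 𝓞 ℚ) ∉ v.asIdeal →
      (primesEquiv v : ℕ) ≠ p ∧ ¬ p ∣ reductionPointCount W (primesEquiv v : ℕ))
    (hgood : ∀ v ∉ S, (p : 𝓞 ℚ) ∉ v.asIdeal ∧ W.HasGoodReductionAt v)
    (Dh : PAdicHeightData W p) (hlow : CycLowerBoundAt W p Dh) :
    MissingLowerBoundAt W p :=
  missingLowerBoundAt_rankZero_of_cycLowerBound_weakSocket W p hGZK hr htors S hS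
    (fun κ _ _ hpv ↦ AdditivePotMult.ClassX3M.localTowerKerPrimary_zero_eq_bot hT41 hX hpv κ) hgood Dh
    hlow

/-! ### §2 CAPSTONES -/

/-- **X4(M), `r_an = 0`, `ρ̄_{E,p}` onto, EVERY odd `p`: `BSD(E,p)` from PRINTED facts (Tate A41 `hT41`,
Delbourgo 1998 Prop. 4 `hDel98`, GZK, modularity, Wuthrich Lemma 20 / Kato `ω^{(p−1)/2}`-component),
census place data with ONLY `p ∤ N_ℓ` at the bad `ℓ ≠ p` (Tamagawa numbers free), and the ONE typed
input `CycLowerBoundAt W p Dh`** — upper half = the class-wide kernel theorem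
`AdditivePotMult.ClassX4M.missingUpperBoundAt_rankZero_of_surj`, lower half = this file's (M) twin. On
r2's GEN 34 column (EVIDENCE) this is the shape read by the 8 `OPEN:LOWER(M)+TAM` demand rows @ 5 that
pass `p ∤ N_ℓ` and the (M)-surj `W = 2` receivers @ 3. X4(M) stays CONSTRUCTION-SHAPED (typed input
OPEN); nothing booked; no label moves on this theorem's word.
[cite: Delbourgo1998, Prop. 4 (p. 144)] [cite: SilvermanATAEC1994, Ch. V Thm. 5.3, Cor. 5.4]
[cite: GreenbergLNM1716, §3 Lemma 3.5 (p. 90), Prop. 3.8 (pp. 95–96) and §4 Thm. 4.1 (pp. 102–104)] [cite: Miller2011LMS, Def. 1.1] -/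
theorem ClassX4M.bsdp_rankZero_of_facts_of_cycLowerBound_tamagawa [W.IsGloballyMinimal]
    (hT41 : Silverman1994_thmV53_corV54_tateUniformisation.{0})
    (hDel98 : Delbourgo1998.prop4_rankZero_pow_dvd_constantCoeff)
    (hGZK : rank_eq_analyticRank_of_analyticRank_le_one) (hmod : hasEntireLFunction_rat)
    (hmodD : nonempty_modularParametrizationData)
    (hL20 : Wuthrich2014.lemma20_surjective_threeAdic_of_semistable)
    (hKato : Wuthrich2014.kato_halfEigenCharIdeal_dvd_cyclotomicPrime_of_surjective)
    (hX : AdditivePotMult.ClassX4M W p) (hr : W.analyticRank = 0) (hsurj : Surj W p)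
    (S : Finset (HeightOneSpectrum (𝓞 ℚ)))
    (hS : ∀ v ∈ S, (p : 𝓞 ℚ) ∉ v.asIdeal →
      (primesEquiv v : ℕ) ≠ p ∧ ¬ p ∣ reductionPointCount W (primesEquiv v : ℕ))
    (hgood : ∀ v ∉ S, (p : 𝓞 ℚ) ∉ v.asIdeal ∧ W.HasGoodReductionAt v)
    (Dh : PAdicHeightData W p) (hlow : CycLowerBoundAt W p Dh) : BSDp W p :=
  bsdp_of_missingPPartAt W p hGZK (by rw [hr]; exact zero_le_one)
    (missingPPartAt_of_lower_of_upper W p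
      (ClassX4M.missingLowerBoundAt_rankZero_of_cycLowerBound_tamagawa hT41 hX hGZK hr S hS hgood Dh
        hlow)
      (AdditivePotMult.ClassX4M.missingUpperBoundAt_rankZero_of_surj hDel98 hGZK hmod hmodD hL20 hKato hX
        hr hsurj))

end Summit.BirchSwinnertonDyer.Rank1Residual.Additive

end
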